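import Mathlib
import Summits.CriticalPhenomena.CardyFormulaZ2.Theorems.CardySelfRefinementLagHandOffFirstContactContinuity
import Literature.Probability.RandomPlanarGeometry.CurveClassStopAtMeasurable
import Summits.CriticalPhenomena.SAWScalingLimit.Theorems.SAWRestrictionRigidityAxiomsOfLimitMarkovKernelPassage
import HarnessLib

/-!
# Joint convergence of (past, future) at a closed set from convergence in law and a.s. immediate entry

Crux `AxiomsOfLimit` (stmt-CriticalPhenomena-1370), line `registered` (= `split`), stub `stub_markovOfLimit`: Markov passage,
part 6 (lead c3). Theorems only.

Hypothesis (a) of `AxiomsOfLimitMarkov.markov_clause_of_lattice_passage` (part 3) is the joint convergence in law of the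
split `(stopAt F, startFrom F)` of the lattice curves to the split of the limit. By the extended (here: almost-) continuous
mapping theorem it follows from convergence in law of the curves themselves (`(lim)`) as soon as the split map is continuous
at almost every limit curve. The tree's first-contact analysis (`…HittingTournament.FirstContact.continuousAt_curveClassStopAt`,
CardyFormulaZ2) gives continuity of the PAST `stopAt F` at classes of IMMEDIATE-ENTRY curves (after first hitting `F` the
curve visits the interior of `F` at parameters arbitrarily close; no condition when it never hits); this file adds the
FUTURE `startFrom F` (same two-sided control of the hitting parameter, tails `γ ∘ affineClamp t (1 - t)`) and draws the
probabilistic consequence: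

* `exists_forall_dist_startFrom_lt`, `continuousAt_startFrom`, `continuousAt_curveClassStartFrom` — continuity of the
  final segment at immediate-entry curves, on parametrised curves and on classes;
* `continuousAt_split` — continuity of `c ↦ (c.stopAt F, c.startFrom F)` at the class of an immediate-entry curve;
* `tendsto_integral_split_of_ae_continuousAt` — if `C n → μ` in law on `CurveClass ℂ` and the split map is continuous at
  `μ`-a.e. class, then `(stopAt F (C n), startFrom F (C n)) → (stopAt F, startFrom F)_* μ` in law (bounded continuous test
  functions on the product) — literally hypothesis (a) of part 3;
* `tendsto_integral_split_of_ae_entry` — the same from `μ`-a.e. immediate entry ("no grazing of `F`").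

References: M. Aizenman, A. Burchard, Duke Math. J. 99 (1999) §2.1; P. Billingsley, *Convergence of Probability Measures*
(1999), Thm 2.7; W. Werner (2007), §3.2 (2). All [folklore].
-/

noncomputable section

open MeasureTheory ProbabilityTheory Filter Topology Set Metric BoundedContinuousFunction
open scoped NNReal ENNReal unitInterval

namespace Summit.CriticalPhenomena.SAWScalingLimit.Theorems.AxiomsOfLimitMarkov

open Literature.Probability.RandomPlanarGeometry
open Summit.CriticalPhenomena.CardyFormulaZ2.Cruxes.LagHandOff.HittingTournament

/-! ### The final segment at immediate-entry curves -/

section Deterministic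

variable {E : Type*}

/-- **Final segments of uniformly close curves.** Under immediate entry (or `σ = 1`), for closed `F` and every `ε > 0`, all
curves `c` uniformly close to `γ` have final segment `c.startFrom F` at reparametrisation distance `< ε` from `γ.startFrom F`
(`c.startFrom F = c ∘ affineClamp σ_c (1 - σ_c)` is uniformly close to `γ ∘ affineClamp σ_c (1 - σ_c)`, which is close to
`γ.startFrom F` by uniform continuity of `γ`, since `σ_c` is close to `σ`: tree `FirstContact.exists_forall_dist_stopAt_lt`).
[folklore] -/
theorem exists_forall_dist_startFrom_lt [PseudoMetricSpace E] {F : Set E} (hF : IsClosed F) (γ : Curve E)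
    (hent : γ.hitParam F < 1 → ∀ ε : ℝ, 0 < ε →
      ∃ t : I, γ.hitParam F < (t : ℝ) ∧ (t : ℝ) < γ.hitParam F + ε ∧ γ t ∈ interior F)
    {ε : ℝ} (hε : 0 < ε) :
    ∃ δ > 0, ∀ c : Curve E, dist γ.toContinuousMap c.toContinuousMap < δ →
      dist (c.startFrom F) (γ.startFrom F) < ε := by
  obtain ⟨δ₁, hδ₁, hmod⟩ := Curve.exists_dist_comp_affineClamp_le γ (half_pos hε)
  obtain ⟨δ₂, hδ₂, hhit⟩ := FirstContact.exists_forall_dist_stopAt_lt hF γ hent (lt_min hδ₁ hε)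
  refine ⟨min (ε / 2) δ₂, lt_min (half_pos hε) hδ₂, fun c hc => ?_⟩
  rw [lt_min_iff] at hc
  obtain ⟨hcε, hc₂⟩ := hc
  have hT : |c.hitParam F - γ.hitParam F| ≤ δ₁ := ((hhit c hc₂).1).trans (min_le_left _ _)
  have hT' : |(1 - c.hitParam F) - (1 - γ.hitParam F)| ≤ δ₁ := by
    rw [show (1 - c.hitParam F) - (1 - γ.hitParam F) = -(c.hitParam F - γ.hitParam F) by ring, abs_neg]
    exact hT
  calc dist (c.startFrom F) (γ.startFrom F)
      ≤ dist (c.startFrom F)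
            (⟨γ.toContinuousMap.comp (Curve.affineClamp (c.hitParam F) (1 - c.hitParam F))⟩ : Curve E) +
          dist (⟨γ.toContinuousMap.comp (Curve.affineClamp (c.hitParam F) (1 - c.hitParam F))⟩ : Curve E)
            (γ.startFrom F) := dist_triangle _ _ _
    _ < ε / 2 + ε / 2 := by
        refine add_lt_add_of_lt_of_le ?_ ?_
        · refine (Curve.dist_comp_comp_le_dist c γ _).trans_lt ?_
          rwa [dist_comm]
        · exact hmod (c.hitParam F) (1 - c.hitParam F) (γ.hitParam F) (1 - γ.hitParam F) hT hT'
    _ = ε := add_halves ε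

/-- **Continuity of `startFrom F` on parametrised curves** at immediate-entry curves (closed `F`), for the
reparametrisation pseudo-distance (reduction to uniformly close curves by `Curve.exists_dist_reparam_lt` and
`Curve.dist_startFrom_startFrom_eq_zero`). [folklore] -/
theorem continuousAt_startFrom [MetricSpace E] {F : Set E} (hF : IsClosed F) {γ : Curve E}
    (hent : γ.hitParam F < 1 → ∀ ε : ℝ, 0 < ε →
      ∃ t : I, γ.hitParam F < (t : ℝ) ∧ (t : ℝ) < γ.hitParam F + ε ∧ γ t ∈ interior F) :
    ContinuousAt (fun c : Curve E => c.startFrom F) γ := by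
  rw [Metric.continuousAt_iff]
  intro ε hε
  obtain ⟨δ, hδ, h⟩ := exists_forall_dist_startFrom_lt hF γ hent hε
  refine ⟨δ, hδ, fun c hc => ?_⟩
  rw [dist_comm] at hc
  obtain ⟨φ, hφ⟩ := Curve.exists_dist_reparam_lt hc
  have h0 : dist (c.startFrom F) ((c.reparam φ).startFrom F) = 0 :=
    Curve.dist_startFrom_startFrom_eq_zero hF (Curve.dist_reparam_self c φ)
  calc dist (c.startFrom F) (γ.startFrom F)
      ≤ dist (c.startFrom F) ((c.reparam φ).startFrom F) +
          dist ((c.reparam φ).startFrom F) (γ.startFrom F) := dist_triangle _ _ _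
    _ = dist ((c.reparam φ).startFrom F) (γ.startFrom F) := by rw [h0, zero_add]
    _ < ε := h _ hφ

/-- **Continuity of `CurveClass.startFrom F` at the class of an immediate-entry curve** (open quotient map `mk` and
representative independence `CurveClass.startFrom_mk_holds`). [folklore] -/
theorem continuousAt_curveClassStartFrom [MetricSpace E] {F : Set E} (hF : IsClosed F) {γ : Curve E}
    (hent : γ.hitParam F < 1 → ∀ ε : ℝ, 0 < ε →
      ∃ t : I, γ.hitParam F < (t : ℝ) ∧ (t : ℝ) < γ.hitParam F + ε ∧ γ t ∈ interior F) :
    ContinuousAt (CurveClass.startFrom F) (CurveClass.mk γ) := by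
  have hfun : (fun c : Curve E => CurveClass.mk (c.startFrom F)) = CurveClass.startFrom F ∘ CurveClass.mk := by
    funext c
    exact (CurveClass.startFrom_mk_holds F hF c).symm
  rw [← FirstContact.isOpenQuotientMap_curveClassMk.continuousAt_comp_iff, ← hfun]
  exact (CurveClass.continuous_mk.tendsto _).comp (continuousAt_startFrom hF hent)

/-- **Continuity of the split map** `c ↦ (c.stopAt F, c.startFrom F)` at the class of an immediate-entry curve.
[folklore] -/
theorem continuousAt_split [MetricSpace E] {F : Set E} (hF : IsClosed F) {γ : Curve E}
    (hent : γ.hitParam F < 1 → ∀ ε : ℝ, 0 < ε →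
      ∃ t : I, γ.hitParam F < (t : ℝ) ∧ (t : ℝ) < γ.hitParam F + ε ∧ γ t ∈ interior F) :
    ContinuousAt (fun c : CurveClass E => (c.stopAt F, c.startFrom F)) (CurveClass.mk γ) :=
  (FirstContact.continuousAt_curveClassStopAt hF hent).prodMk (continuousAt_curveClassStartFrom hF hent)

end Deterministic

/-! ### Joint convergence in law of (past, future) -/

section InLaw

variable {Ωs : ℕ → Type*} {mΩ : ∀ n, MeasurableSpace (Ωs n)} {P : ∀ n, Measure (Ωs n)}
  [∀ n, IsProbabilityMeasure (P n)] {μ : Measure (CurveClass ℂ)} [IsProbabilityMeasure μ]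
  {C : ∀ n, Ωs n → CurveClass ℂ}

/-- **Joint convergence of (past, future) from convergence in law and a.s. continuity of the split map.** If the curve
classes `C n` converge in law to `μ` (bounded continuous test functions) and `c ↦ (c.stopAt F, c.startFrom F)` is
continuous at `μ`-a.e. class (`F` closed), then the split pairs converge in law to the split of `μ`: for every bounded
continuous `φ` on `CurveClass ℂ × CurveClass ℂ`, `∫ φ (stopAt F (C n), startFrom F (C n)) dP n → ∫ φ (stopAt F γ,
startFrom F γ) dμ` — hypothesis (a) of `markov_clause_of_lattice_passage` (part 3). Engine: the tree's extended
almost-continuous mapping theorem with constant maps and good sets `univ`. [folklore] -/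
theorem tendsto_integral_split_of_ae_continuousAt (hC : ∀ n, Measurable (C n)) {F : Set ℂ} (hF : IsClosed F)
    (hlim : ∀ f : CurveClass ℂ →ᵇ ℝ, Tendsto (fun n => ∫ ω, f (C n ω) ∂P n) atTop (𝓝 (∫ γ, f γ ∂μ)))
    (hcont : ∀ᵐ c ∂μ, ContinuousAt (fun c : CurveClass ℂ => (c.stopAt F, c.startFrom F)) c)
    (φ : CurveClass ℂ × CurveClass ℂ →ᵇ ℝ) :
    Tendsto (fun n => ∫ ω, φ ((C n ω).stopAt F, (C n ω).startFrom F) ∂P n) atTop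
      (𝓝 (∫ γ, φ (γ.stopAt F, γ.startFrom F) ∂μ)) := by
  -- convergence in distribution of the curves to the identity under `μ`
  have hTD : TendstoInDistribution C atTop (id : CurveClass ℂ → CurveClass ℂ) P μ :=
    tendstoInDistribution_of_tendsto_integral (fun n => (hC n).aemeasurable) aemeasurable_id
      (by simpa only [id_eq] using hlim)
  set ψ : CurveClass ℂ → CurveClass ℂ × CurveClass ℂ := fun c => (c.stopAt F, c.startFrom F) with hψ_def
  have hψm : Measurable ψ := (CurveClass.measurable_stopAt hF).prodMk (CurveClass.measurable_startFrom hF)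
  have hcomp : TendstoInDistribution (fun n => ψ ∘ C n) atTop (ψ ∘ id) P μ := by
    refine Literature.Probability.Process.tendstoInDistribution_comp_of_forall_exists_seq_tendsto
      (F' := CurveClass ℂ × CurveClass ℂ) hTD (fun _ => hψm) hψm fun ε _ =>
        ⟨fun _ => univ, fun _ => MeasurableSet.univ, Eventually.of_forall fun n => by simp, ?_⟩
    rw [Measure.map_id]
    filter_upwards [hcont] with c hc u _ xs _ hxs
    exact hc.tendsto.comp hxs
  have key := (ProbabilityMeasure.tendsto_iff_forall_integral_tendsto.1 hcomp.tendsto) φ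
  simp only [ProbabilityMeasure.coe_mk] at key
  have hn : ∀ n, ∫ x, φ x ∂((P n).map (ψ ∘ C n)) = ∫ ω, φ ((C n ω).stopAt F, (C n ω).startFrom F) ∂P n :=
    fun n => integral_map (hψm.comp (hC n)).aemeasurable φ.continuous.aestronglyMeasurable
  have h0 : ∫ x, φ x ∂(μ.map (ψ ∘ id)) = ∫ γ, φ (γ.stopAt F, γ.startFrom F) ∂μ := by
    rw [Function.comp_id, integral_map hψm.aemeasurable φ.continuous.aestronglyMeasurable]
  simp_rw [hn, h0] at key
  exact key

/-- **Joint convergence of (past, future) from convergence in law and a.s. immediate entry** ("no grazing of `F`"): if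
`μ`-a.e. class is the class of a curve which, after first hitting the closed set `F` at `σ < 1`, visits the interior of `F`
at parameters arbitrarily close to `σ`, then hypothesis (a) of part 3 holds at `F`. [folklore] -/
theorem tendsto_integral_split_of_ae_entry (hC : ∀ n, Measurable (C n)) {F : Set ℂ} (hF : IsClosed F)
    (hlim : ∀ f : CurveClass ℂ →ᵇ ℝ, Tendsto (fun n => ∫ ω, f (C n ω) ∂P n) atTop (𝓝 (∫ γ, f γ ∂μ)))
    (hent : ∀ᵐ c ∂μ, ∃ γ : Curve ℂ, CurveClass.mk γ = c ∧ (γ.hitParam F < 1 → ∀ ε : ℝ, 0 < ε →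
      ∃ t : I, γ.hitParam F < (t : ℝ) ∧ (t : ℝ) < γ.hitParam F + ε ∧ γ t ∈ interior F))
    (φ : CurveClass ℂ × CurveClass ℂ →ᵇ ℝ) :
    Tendsto (fun n => ∫ ω, φ ((C n ω).stopAt F, (C n ω).startFrom F) ∂P n) atTop
      (𝓝 (∫ γ, φ (γ.stopAt F, γ.startFrom F) ∂μ)) := by
  refine tendsto_integral_split_of_ae_continuousAt hC hF hlim ?_ φ
  filter_upwards [hent] with c hc
  obtain ⟨γ, rfl, hγ⟩ := hc
  exact continuousAt_split hF hγ


/-! ### Registered sub-goal of crux stmt-CriticalPhenomena-1370 (line `registered`, stub `stub_markovOfLimit`) -/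

/-- **Registered sub-goal `stub_jointSplitConvergence`** (crux stmt-CriticalPhenomena-1370, Markov passage, part 6):
`tendsto_integral_split_of_ae_entry` with all binders explicit, notation-free, lattice sample spaces at universe level `0`:
hypothesis (a) of `markov_clause_of_lattice_passage` from convergence in law of the curves and a.s. immediate entry into the
closed set `F`. [folklore] -/
theorem stub_jointSplitConvergence :
    ∀ (Ωs : ℕ → Type) [∀ n, MeasurableSpace (Ωs n)] (P : ∀ n, MeasureTheory.Measure (Ωs n)) [∀ n, MeasureTheory.IsProbabilityMeasure (P n)] (μ : MeasureTheory.Measure (Literature.Probability.RandomPlanarGeometry.CurveClass ℂ)) [MeasureTheory.IsProbabilityMeasure μ] (C : ∀ n, Ωs n → Literature.Probability.RandomPlanarGeometry.CurveClass ℂ), (∀ n, Measurable (C n)) → ∀ (F : Set ℂ), IsClosed F → (∀ f : BoundedContinuousFunction (Literature.Probability.RandomPlanarGeometry.CurveClass ℂ) ℝ, Filter.Tendsto (fun n => MeasureTheory.integral (P n) (fun ω => f (C n ω))) Filter.atTop (nhds (MeasureTheory.integral μ (fun γ => f γ)))) → Filter.Eventually (fun c => ∃ γ : Literature.Probability.RandomPlanarGeometry.Curve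 ℂ, Literature.Probability.RandomPlanarGeometry.CurveClass.mk γ = c ∧ (γ.hitParam F < 1 → ∀ ε : ℝ, 0 < ε → ∃ t : unitInterval, γ.hitParam F < (t : ℝ) ∧ (t : ℝ) < γ.hitParam F + ε ∧ γ t ∈ interior F)) (MeasureTheory.ae μ) → ∀ φ : BoundedContinuousFunction (Literature.Probability.RandomPlanarGeometry.CurveClass ℂ × Literature.Probability.RandomPlanarGeometry.CurveClass ℂ) ℝ, Filter.Tendsto (fun n => MeasureTheory.integral (P n) (fun ω => φ ((C n ω).stopAt F, (C n ω).startFrom F))) Filter.atTop (nhds (MeasureTheory.integral μ (fun γ => φ (γ.stopAt F, γ.startFrom F)))) :=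
  fun _ _ _ _ _ _ _ hC _ hF hlim hent φ => tendsto_integral_split_of_ae_entry hC hF hlim hent φ

end InLaw

end Summit.CriticalPhenomena.SAWScalingLimit.Theorems.AxiomsOfLimitMarkov

end
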